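import Literature.AnabelianGeometry.SemiGraphs.ThetaRayEscapeLevelData
import Literature.AnabelianGeometry.SemiGraphs.ThetaRayCharacter
import Literature.AnabelianGeometry.SemiGraphs.ThetaRayCriticalSubjoint
import Literature.AnabelianGeometry.SemiGraphs.TemperedPiBranchStabilizerImage
import Literature.AnabelianGeometry.SemiGraphs.TemperedPiDecompositionStab
import Literature.AnabelianGeometry.SemiGraphs.TemperedPiCoverMaps
import HarnessLib

/-!
# No critical sub-joint at the canonical tower of `𝒢_θ` — the `hcrit` producer (REFUTE-F1732, R6-level)

Mochizuki, *Semi-graphs of anabelioids*, Publ. RIMS **42** (2006) [MochizukiSemiAnbd2006], §3,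
Theorem 3.7 (iii), author's manuscript pp. 40–41, proof p. 41 (the sub-joint argument)
[cite: MochizukiSemiAnbd2006, Thm 3.7(iii) p.41]; printed proof = finite `𝔾` (kernel p431007).
FRONTIER programme REFUTE-F1732 (plan/L3/SUBDAG-SemiAnbd-Thm37iii-REFUTE.md; honest framing α59: towards a
kernel erratum for the ∀-countable reading of Thm 3.7 (iii) as amended by [IUTchI] Rmk 2.5.3; desk
countermodel `𝒢_θ` of abc-iut-L3-d1, memo COUNTERMODEL-Thm37iii-infinite.md sha16 8b26b5199c29f55f (2c)).

PROOF-ONLY file (abc-iut-L3-d4; 0 definitions, no named fact).  The LAST binder `hcrit` of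
abc-iut-L3-t11's `thetaRay_not_compactInVerticial_of_hcrit` (p439805; (hz)/(hfin)/(hfar) discharged there
over `thetaRay_not_compactInVerticialAt_of_levelEscape`, p438249) is produced from LEVEL DATA in binder
form: for every height `n`, a continuous character `χG n : G → A n` (finite discrete abelian) compatible
with the gluings, an abelian quotient `ab n : G → V n` whose kernel contains the point stabilisers of the
canonical tower from some level on (hK — abc-iut-L3-t6's `exists_level_hK` at the characteristic cores),
and the MODEL ARITHMETIC (hsep — abc-iut-w6-d096 p437555 / brick R1 part 3): then the explicit apartment
generators `z k = ψ_{k+1}(up e₀)` fix no critical sub-joint at height `n + 1` at deep levels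
(`thetaRay_hcrit_of_characters`), by `SemiGraph.ray_not_critical_of_characters` (p437320) fed with the level
characters of `thetaRay_exists_levelCharacter` (p440079) and the Bass–Serre local structure
`PointSeq.exists_gal_conj_brHom_of_edgeMap_eq` (abc-iut-L3-t11, p437340).  Tool: every vertex of a tree of
the Galois tower lies under a compatible point sequence (`GaloisLevelData.exists_pointSeq_vertex_eq_at`).
Corollaries `thetaRay_not_compactInVerticialAt_of_characters` / `thetaRay_not_compactInVerticial_of_characters`:
`CompactInVerticialAt (thetaRay G E up low)` and the ∀-countable `CompactInVerticial.{0}` FAIL modulo these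
binders (and `Thm37Hypotheses`, (hcoin)) — NEGATIVE-MODULO; the bricks R1/R4/R5 instantiate them at
`G = F̂_p⟨a,b⟩`.  Nothing here bears on [IUTchIII] Cor. 3.12 (IUT uses finite dual semi-graphs only).
-/

noncomputable section

namespace Literature.AnabelianGeometry.SemiGraphs

open CategoryTheory Topology

universe u

/-! ### Every tree vertex lies under a compatible point sequence -/

namespace ProfiniteSemiGraph

namespace GaloisLevelData

variable {𝒢 : ProfiniteSemiGraph.{u}} (D : GaloisLevelData 𝒢) (h𝒢 : 𝒢.IsCountable)

include h𝒢 in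
/-- The transition `𝔾̃_{n+1} → 𝔾̃_n` of the trees of a Galois tower is surjective on vertices (the
covering `𝒢_{∞,n+1} → 𝒢_{∞,n}` is surjective on every fibre). [cite: MochizukiSemiAnbd2006, Prop 3.6 p.38] -/
theorem treeStep_vertexMap_surjective (n : ℕ) : Function.Surjective (D.treeStep n).vertexMap := by
  intro x
  obtain ⟨t, ht⟩ := exists_point_over (h𝒢 := h𝒢) n x rfl
  obtain ⟨t', ht'⟩ := D.levelMap_fV_surjective h𝒢 n _ t
  refine ⟨(D.treeIso h𝒢 (n + 1)).hom.vertexMap (Quot.mk _ ⟨_, t'⟩), ?_⟩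
  rw [D.treeStep_vertexMap_mk h𝒢 n]
  have h1 : ((D.stepCover h𝒢 n).fV _).hom.hom t' = t := ht'
  rw [h1, ht]

/-- From one-step compatibility to compatibility under all transition maps.
[cite: MochizukiSemiAnbd2006, Thm 3.7(iii) p.41] -/
theorem treeTrans_vertexMap_of_step (x : ∀ n, (D.tree n).Vertex)
    (hx : ∀ n, (D.treeStep n).vertexMap (x (n + 1)) = x n) :
    ∀ ⦃i k : ℕ⦄ (h : i ≤ k), (D.treeTrans h).vertexMap (x k) = x i := by
  intro i k h
  induction k, h using Nat.le_induction with
  | base => rw [D.treeTrans_self]; rfl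
  | succ k h ih => rw [D.treeTrans_succ h, SemiGraph.comp_vertexMap, Function.comp_apply, hx k, ih]

include h𝒢 in
/-- **Every vertex of a tree `𝔾̃_j` of the tower lies on a compatible vertex system** (push down by the
transition maps, lift up by their surjectivity). [cite: MochizukiSemiAnbd2006, Thm 3.7(iii) p.41] -/
theorem exists_compatible_vertexSystem_through (j : ℕ) (y : (D.tree j).Vertex) :
    ∃ x : ∀ n, (D.tree n).Vertex, (∀ n, (D.treeStep n).vertexMap (x (n + 1)) = x n) ∧ x j = y := by
  classical
  have hs : ∀ (n : ℕ) (u : (D.tree n).Vertex), ∃ a : (D.tree (n + 1)).Vertex, (D.treeStep n).vertexMap a = u :=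
    fun n u => D.treeStep_vertexMap_surjective h𝒢 n u
  choose lift hlift using hs
  let x : ∀ n, (D.tree n).Vertex := fun n =>
    Nat.rec (motive := fun n => (D.tree n).Vertex) ((D.treeTrans (Nat.zero_le j)).vertexMap y)
      (fun n xn => if h : n + 1 ≤ j then (D.treeTrans h).vertexMap y else lift n xn) n
  have hx_succ : ∀ n, x (n + 1) = if h : n + 1 ≤ j then (D.treeTrans h).vertexMap y else lift n (x n) :=
    fun _ => rfl
  have hx_le : ∀ n (h : n ≤ j), x n = (D.treeTrans h).vertexMap y := by
    intro n h
    cases n with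
    | zero => rfl
    | succ n => rw [hx_succ, dif_pos h]
  refine ⟨x, fun n => ?_, ?_⟩
  · by_cases h : n + 1 ≤ j
    · rw [hx_le (n + 1) h, hx_le n (Nat.le_of_succ_le h), ← D.treeTrans_le_succ n,
        ← Function.comp_apply (f := (D.treeTrans (Nat.le_succ n)).vertexMap), ← SemiGraph.comp_vertexMap,
        D.treeTrans_comp]
    · rw [hx_succ, dif_neg h]
      exact hlift n (x n)
  · rw [hx_le j le_rfl, D.treeTrans_self]
    rfl

/-- **Every vertex of `𝔾̃_j` is the `j`-th vertex of a compatible point sequence** of the tower (over its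
base vertex). [cite: MochizukiSemiAnbd2006, Thm 3.7(iii) p.41] -/
theorem exists_pointSeq_vertex_eq_at (j : ℕ) (y : (D.tree j).Vertex) :
    ∃ (v : 𝒢.graph.Vertex) (P : D.PointSeq h𝒢 v), P.vertex j = y := by
  obtain ⟨x, hx, hxj⟩ := D.exists_compatible_vertexSystem_through h𝒢 j y
  obtain ⟨v, P, hP⟩ := D.exists_pointSeq_vertex_eq h𝒢 x (D.treeTrans_vertexMap_of_step x hx)
  exact ⟨v, P, (hP j).trans hxj⟩

end GaloisLevelData

end ProfiniteSemiGraph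

/-! ### The `hcrit` producer at `𝒢_θ` -/

open ProfiniteSemiGraph ProfiniteSemiGraph.GaloisLevelData

variable {G E : Type} [Group G] [TopologicalSpace G] [IsTopologicalGroup G] [CompactSpace G]
  [TotallyDisconnectedSpace G] [Group E] [TopologicalSpace E] [IsTopologicalGroup E] [CompactSpace E]
  [TotallyDisconnectedSpace E] {up : E →ₜ* G} {low : ℕ → (E →ₜ* G)}
  {A V : ℕ → Type} [∀ n, CommGroup (A n)] [∀ n, TopologicalSpace (A n)] [∀ n, DiscreteTopology (A n)]
  [∀ n, Finite (A n)] [∀ n, CommGroup (V n)]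

/-- **No critical sub-joint at the canonical tower of `𝒢_θ` from level data** (memo (2c) in the kernel, the
`hcrit` binder of `thetaRay_not_compactInVerticial_of_hcrit`): see the module docstring for the binders
`χG`, `ab`, (hK), (hsep). [cite: MochizukiSemiAnbd2006, Thm 3.7(iii) p.41] -/
theorem thetaRay_hcrit_of_characters (h36 : (thetaRay G E up low).Prop36Hypotheses)
    (P₀ : ((thetaRay G E up low).galoisLevelData h36).PointSeq h36.isCountable (0 : ℕ)) (e₀ : E)
    (χG : ∀ n, G →ₜ* A n) (hχA : ∀ (n k : ℕ) (t : E), χG n (low k t) = χG n (up t))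
    (ab : ∀ n, G →* V n)
    (hK : ∀ n : ℕ, ∃ j₀ : ℕ, ∀ j, j₀ ≤ j → ∀ (w : ℕ)
      (P : ((thetaRay G E up low).galoisLevelData h36).PointSeq h36.isCountable w) (x : G),
      P.gal j x = 1 → ab n x = 1)
    (hsep : ∀ (n : ℕ) (t₁ t₂ : E), χG n (low (n + 1) t₁) = χG n (up e₀) → χG n (up t₂) = χG n (up e₀) →
      ab n (low (n + 1) t₁) ≠ ab n (up t₂)) :
    let D := (thetaRay G E up low).galoisLevelData h36
    let z : ℕ → D.temperedPi h36.isCountable := fun k =>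
      (rayPointSeq (D := D) thetaRay_ham thetaRay_hap thetaRay_hmp P₀ (k + 1)).decompHom
        ((thetaRay G E up low).brHom (k, true) (k + 1) (thetaRay_hap k) e₀)
    ∀ n : ℕ, ∃ j₀ : ℕ, ∀ j, j₀ ≤ j → ∃ N : ℕ, ∀ k, N ≤ k →
      ∀ (y : (D.tree j).Vertex) (b b' : (D.tree j).Branch),
        (D.tree j).abuts b = some y → (D.tree j).abuts b' = some y →
        (D.treeProj j).vertexMap y = n + 1 →
        (D.treeAct h36.isCountable j (z k)).hom.edgeMap ((D.tree j).edgeOf b) = (D.tree j).edgeOf b →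
        (D.treeAct h36.isCountable j (z k)).hom.edgeMap ((D.tree j).edgeOf b') = (D.tree j).edgeOf b' →
        (∃ (b₂ : (D.tree j).Branch) (v₂ : (D.tree j).Vertex), b₂ ≠ b ∧
          (D.tree j).edgeOf b₂ = (D.tree j).edgeOf b ∧ (D.tree j).abuts b₂ = some v₂ ∧
          (D.treeProj j).vertexMap v₂ = n + 2) →
        (∃ (b₂ : (D.tree j).Branch) (v₂ : (D.tree j).Vertex), b₂ ≠ b' ∧
          (D.tree j).edgeOf b₂ = (D.tree j).edgeOf b' ∧ (D.tree j).abuts b₂ = some v₂ ∧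
          (D.treeProj j).vertexMap v₂ = n) →
        False := by
  intro D z n
  obtain ⟨χ, j₁, hχ, hlev⟩ := thetaRay_exists_levelCharacter (up := up) (low := low) h36 (χG n) (hχA n)
  obtain ⟨j₀, hj₀⟩ := hK n
  refine ⟨max j₁ j₀, fun j hj => ⟨0, fun k _ y b b' hb hb' hy he he' hup hdown => ?_⟩⟩
  obtain ⟨χj, hχj, hχjgal⟩ := hlev j (le_of_max_le_left hj)
  -- the critical vertex lies under a point sequence (over some base vertex `w`)
  obtain ⟨w, P, hP⟩ := D.exists_pointSeq_vertex_eq_at h36.isCountable j y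
  -- the one-level algebra
  refine SemiGraph.ray_not_critical_of_characters (D.tree j) (D.treeProj j) (D.treeAct h36.isCountable j (z k))
    up.toMonoidHom (fun m => (low m).toMonoidHom) (ab n) (χG n).toMonoidHom χj
    (D.proj h36.isCountable j (z k)) e₀ (n + 1) y hy ((D.proj h36.isCountable j).comp P.decompHom)
    ?_ ?_ ?_ ?_ ?_ b b' hb hb' he he' hup ?_
  · -- hstab: edge stabilisers at `y` are images of conjugates of the branch subgroups (t11's (c4))
    intro β hβ hfix
    rw [← hP] at hβ
    have hbw : (thetaRay G E up low).graph.abuts ((D.treeProj j).branchMap β) = some w := by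
      have h1 := (D.treeProj j).abuts_branchMap β (P.vertex j) hβ
      rwa [P.treeProj_vertexMap_vertex j] at h1
    obtain ⟨f, t, hft⟩ :=
      P.exists_gal_conj_brHom_of_edgeMap_eq j (z k) ((D.treeProj j).branchMap β) hbw β rfl hβ hfix
    refine ⟨f, t, hft.trans ?_⟩
    change P.gal j _ = P.gal j _
    congr 2
    rw [thetaRay_brHom]
    split_ifs <;> rfl
  · -- hχ
    intro x
    exact (hχj (P.decompHom x)).trans (hχ w P x)
  · -- hσ: `z k = ψ_{k+1}(up e₀)`
    exact (hχj _).trans (hχ _ _ _)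
  · -- hK
    intro x hx
    exact hj₀ j (le_of_max_le_right hj) w P x hx
  · -- hsep
    exact hsep n
  · obtain ⟨b₂, v₂, h1, h2, h3, h4⟩ := hdown
    exact ⟨b₂, v₂, h1, h2, h3, by rw [h4]⟩

/-- **`¬ CompactInVerticialAt (thetaRay G E up low)` from level data** (∘ abc-iut-L3-t11's
`thetaRay_not_compactInVerticialAt_of_hcrit`, p439805).  Remaining binders: `Thm37Hypotheses` (bricks
R3/R4/R5), a base point sequence `P₀`, (hcoin), and the level data `χG`/`ab`/(hK)/(hsep) (bricks R1, t6's
`exists_level_hK`). NEGATIVE-MODULO form. [cite: MochizukiSemiAnbd2006, Thm 3.7(iii) pp.40-41] -/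
theorem thetaRay_not_compactInVerticialAt_of_characters (h37 : (thetaRay G E up low).Thm37Hypotheses)
    (P₀ : ((thetaRay G E up low).galoisLevelData h37.toProp36Hypotheses).PointSeq h37.isCountable (0 : ℕ))
    (e₀ : E) (hcoin : ∀ d : ℕ, ∃ N : ℕ, ∀ k, N ≤ k → (low (k + 1) e₀)⁻¹ * up e₀ ∈ charOpenCore G d)
    (χG : ∀ n, G →ₜ* A n) (hχA : ∀ (n k : ℕ) (t : E), χG n (low k t) = χG n (up t))
    (ab : ∀ n, G →* V n)
    (hK : ∀ n : ℕ, ∃ j₀ : ℕ, ∀ j, j₀ ≤ j → ∀ (w : ℕ)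
      (P : ((thetaRay G E up low).galoisLevelData h37.toProp36Hypotheses).PointSeq h37.isCountable w)
      (x : G), P.gal j x = 1 → ab n x = 1)
    (hsep : ∀ (n : ℕ) (t₁ t₂ : E), χG n (low (n + 1) t₁) = χG n (up e₀) → χG n (up t₂) = χG n (up e₀) →
      ab n (low (n + 1) t₁) ≠ ab n (up t₂)) :
    ¬ CompactInVerticialAt (thetaRay G E up low) :=
  thetaRay_not_compactInVerticialAt_of_hcrit h37 P₀ e₀ hcoin
    (thetaRay_hcrit_of_characters h37.toProp36Hypotheses P₀ e₀ χG hχA ab hK hsep)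

/-- … and the ∀-countable named fact `CompactInVerticial.{0}` (F-1732) FAILS under the same level data.
NEGATIVE-MODULO form. [cite: MochizukiSemiAnbd2006, Thm 3.7(iii) pp.40-41] -/
theorem thetaRay_not_compactInVerticial_of_characters (h37 : (thetaRay G E up low).Thm37Hypotheses)
    (P₀ : ((thetaRay G E up low).galoisLevelData h37.toProp36Hypotheses).PointSeq h37.isCountable (0 : ℕ))
    (e₀ : E) (hcoin : ∀ d : ℕ, ∃ N : ℕ, ∀ k, N ≤ k → (low (k + 1) e₀)⁻¹ * up e₀ ∈ charOpenCore G d)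
    (χG : ∀ n, G →ₜ* A n) (hχA : ∀ (n k : ℕ) (t : E), χG n (low k t) = χG n (up t))
    (ab : ∀ n, G →* V n)
    (hK : ∀ n : ℕ, ∃ j₀ : ℕ, ∀ j, j₀ ≤ j → ∀ (w : ℕ)
      (P : ((thetaRay G E up low).galoisLevelData h37.toProp36Hypotheses).PointSeq h37.isCountable w)
      (x : G), P.gal j x = 1 → ab n x = 1)
    (hsep : ∀ (n : ℕ) (t₁ t₂ : E), χG n (low (n + 1) t₁) = χG n (up e₀) → χG n (up t₂) = χG n (up e₀) →
      ab n (low (n + 1) t₁) ≠ ab n (up t₂)) :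
    ¬ CompactInVerticial.{0} :=
  thetaRay_not_compactInVerticial_of_hcrit h37 P₀ e₀ hcoin
    (thetaRay_hcrit_of_characters h37.toProp36Hypotheses P₀ e₀ χG hχA ab hK hsep)

end Literature.AnabelianGeometry.SemiGraphs

end
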